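import Literature.NumberTheory.EllipticCurves.PadicSeriesEvaluationNormedAlgebra
import Literature.NumberTheory.EllipticCurves.PadicLogOfEvalProofs
import Literature.NumberTheory.Transcendental.PadicLogPrincipalUnits
import HarnessLib

/-!
# The logarithm of the value of an integral power series at a point of a complete ultrametric
# normed `ℚ_p`-algebra is the value of its formal logarithm (proofs only)

Topic `Literature/NumberTheory/EllipticCurves` (trunk T-NT-EC); PROOFS file (theorems only). The tree's
`PadicLogOfEvalProofs.lean` (`log_p F(u) = (log F)(u)` for `F ∈ 1 + Xℤ_p⟦X⟧`, `u ∈ ℚ_p`, `‖u‖ < 1`;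
width seat `bsd-line-cf2-p1-w8` g26) VERBATIM for `u` in a complete ultrametric normed `ℚ_p`-algebra
field `L` (`ℂ_p`), the value `F(u)` being `padicAlgEval L F u` (`PadicSeriesEvaluationNormedAlgebra.lean`)
and the logarithm any function `Log : L → L` which on the principal units `‖1 − y‖ < 1` is the
logarithmic series (`Transcendental.PadicExp.plog`; for `L = ℂ_p` the Iwasawa logarithm of
`PadicComplexIwasawaLogarithm.lean`, Robert V.4.5 property (2)). Fourth brick (A4) of the existence of
the canonical cyclotomic `p`-adic height over a number field (`CanonicalPAdicHeightCyc.lean`), whose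
`p`-part `sigmaSqNormLog` is written with the coefficients of `ℒ_p = log(Σ_p/t²)`.

## Results (for `F ∈ 1 + Xℤ_p⟦X⟧`, `G` with `G(0) = 0`, `dG·F = dF`, `u ∈ L`, `‖u‖ < 1`)

* `hasSum_coeff_subst_mul_pow_alg` — the one-variable Fubini lemma for an outer series with
  `‖[X^k]f‖ ≤ k` (AEC IV.6.4(a)) at `L`-points;
* `hasSum_coeff_mercator_mul_pow_alg` — the Mercator series sums to `plog (1 + v)` in `L`;
* `hasSum_coeff_formalLog_mul_pow_alg`, `log_padicAlgEval`,
  `hasSum_coeff_mul_pow_of_derivative_eq_mul_invOfUnit_alg` — **`Log (F(u)) = Σ_n ι([Xⁿ]G) uⁿ`**.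

## References

* K. Iwasawa, *Lectures on p-adic L-functions* (1972), §4.4. [Iwasawa1972PadicL]
* J. H. Silverman, *The Arithmetic of Elliptic Curves*, 2nd ed. (2009), IV.6.3(a), IV.6.4(a). [SilvermanAEC2009]
* A. M. Robert, *A Course in p-adic Analysis* (2000), Ch. V §4.5 (the Iwasawa logarithm on `ℂ_p`). [Robert2000PadicAnalysis]
-/

noncomputable section

open PowerSeries Filter
open scoped Topology
open Literature.NumberTheory.Transcendental

namespace Literature.NumberTheory.EllipticCurves

variable {p : ℕ} [Fact p.Prime] {L : Type*} [NontriviallyNormedField L] [NormedAlgebra ℚ_[p] L]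
  [IsUltrametricDist L] [CompleteSpace L]

/-! ### §1 The one-variable Fubini lemma at `L`-points -/

section Fubini

variable {f A : ℚ_[p]⟦X⟧} {u : L}

omit [IsUltrametricDist L] [CompleteSpace L] in
/-- `‖ι c‖ = ‖c‖`. [folklore] -/
private theorem norm_algebraMap_eq (c : ℚ_[p]) : ‖algebraMap ℚ_[p] L c‖ = ‖c‖ := norm_algebraMap' L c

/-- `[Xⁿ](A^k) = 0` for `n < k` when `A(0) = 0`. [folklore] -/
private theorem coeff_pow_eq_zero_of_lt' {A : ℚ_[p]⟦X⟧} (hA0 : constantCoeff A = 0) {n k : ℕ}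
    (h : n < k) : coeff n (A ^ k) = 0 := by
  have h1 : (1 : ℕ∞) ≤ A.order := (one_le_order_iff_constCoeff_eq_zero).mpr hA0
  have hk : ((k : ℕ) : ℕ∞) ≤ (A ^ k).order :=
    calc ((k : ℕ) : ℕ∞) = k • (1 : ℕ∞) := by simp
      _ ≤ k • A.order := nsmul_le_nsmul_right h1 k
      _ ≤ (A ^ k).order := le_order_pow A k
  exact coeff_of_lt_order n (lt_of_lt_of_le (by exact_mod_cast h) hk)

/-- **Summability of the double family** `(k, n) ↦ ι([X^k]f) · ι([Xⁿ]A^k) · uⁿ` in `L` for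
`‖[X^k]f‖ ≤ k`, `A` integral without constant term, `‖u‖ < 1` (terms bounded by `n ‖u‖ⁿ → 0`).
[cite: SilvermanAEC2009, IV.6.3 and IV.6.4] -/
theorem summable_coeff_mul_coeff_pow_mul_pow_alg (hf : ∀ k, ‖coeff k f‖ ≤ k) (hA : IsPadicInt A)
    (hA0 : constantCoeff A = 0) (hu : ‖u‖ < 1) :
    Summable fun x : ℕ × ℕ => algebraMap ℚ_[p] L (coeff x.1 f) *
      (algebraMap ℚ_[p] L (coeff x.2 (A ^ x.1)) * u ^ x.2) := by
  refine NonarchimedeanAddGroup.summable_of_tendsto_cofinite_zero ?_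
  set r := ‖u‖ with hr
  have hr0 : 0 ≤ r := norm_nonneg u
  -- the bound `‖term (k, n)‖ ≤ n r^n`
  have hbound : ∀ x : ℕ × ℕ,
      ‖algebraMap ℚ_[p] L (coeff x.1 f) * (algebraMap ℚ_[p] L (coeff x.2 (A ^ x.1)) * u ^ x.2)‖ ≤
        (x.2 : ℝ) * r ^ x.2 := by
    rintro ⟨k, n⟩
    dsimp only
    by_cases hnk : n < k
    · rw [coeff_pow_eq_zero_of_lt' hA0 hnk, map_zero, zero_mul, mul_zero, norm_zero]
      exact mul_nonneg (Nat.cast_nonneg _) (pow_nonneg hr0 _)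
    · push Not at hnk
      have b1 : ‖coeff k f‖ ≤ k := hf k
      have b2 : ‖coeff n (A ^ k)‖ ≤ 1 := isPadicInt_iff_coeff.mp (hA.pow k) n
      have b5 : (k : ℝ) ≤ n := by exact_mod_cast hnk
      rw [norm_mul, norm_mul, norm_pow, norm_algebraMap_eq, norm_algebraMap_eq]
      calc ‖coeff k f‖ * (‖coeff n (A ^ k)‖ * ‖u‖ ^ n) ≤ k * (1 * r ^ n) := by gcongr
        _ = k * r ^ n := by rw [one_mul]
        _ ≤ n * r ^ n := by gcongr
  -- `n r^n → 0`
  rw [NormedAddGroup.tendsto_nhds_zero]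
  intro ε hε
  obtain ⟨N, hN⟩ : ∃ N : ℕ, ∀ m, N ≤ m → (m : ℝ) * r ^ m < ε := by
    have h := tendsto_self_mul_const_pow_of_lt_one hr0 hu
    rw [Metric.tendsto_atTop] at h
    obtain ⟨N, hN⟩ := h ε hε
    refine ⟨N, fun m hm => ?_⟩
    have := hN m hm
    rw [Real.dist_eq, sub_zero,
      abs_of_nonneg (mul_nonneg (Nat.cast_nonneg _) (pow_nonneg hr0 _))] at this
    exact this
  -- the exceptional set is finite
  have hfin : {x : ℕ × ℕ | x.1 ≤ x.2 ∧ x.2 < N}.Finite := by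
    refine ((Set.finite_Iio N).prod (Set.finite_Iio N)).subset ?_
    intro x hx
    obtain ⟨h1, h2⟩ := hx
    simp only [Set.mem_prod, Set.mem_Iio]
    exact ⟨by omega, h2⟩
  rw [Filter.eventually_cofinite]
  refine hfin.subset fun x hx => ?_
  simp only [Set.mem_setOf_eq] at hx ⊢
  have hx' := not_lt.mp hx
  by_contra hcon
  push Not at hcon
  by_cases hnk : x.2 < x.1
  · rw [coeff_pow_eq_zero_of_lt' hA0 hnk, map_zero, zero_mul, mul_zero, norm_zero] at hx'
    exact absurd hε (not_lt.mpr hx')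
  · push Not at hnk
    exact absurd ((hbound x).trans_lt (hN _ (hcon hnk))) (not_lt.mpr hx')

/-- **Evaluation commutes with substitution at `L`-points, outer series with `‖[X^k]f‖ ≤ k`** (the
Fubini argument of AEC IV.6.4(a), one variable): for `A ∈ Xℤ_p⟦X⟧` and `‖u‖ < 1`, the series
`Σ_n ι([Xⁿ](f∘A)) uⁿ` converges to `f(A(u)) = Σ' ι([X^k]f) · A(u)^k`. [cite: SilvermanAEC2009, IV.6.4] -/
theorem hasSum_coeff_subst_mul_pow_alg (hf : ∀ k, ‖coeff k f‖ ≤ k) (hA : IsPadicInt A)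
    (hA0 : constantCoeff A = 0) (hu : ‖u‖ < 1) :
    HasSum (fun n : ℕ => algebraMap ℚ_[p] L (coeff n (f.subst A)) * u ^ n)
      (padicAlgEval L f (padicAlgEval L A u)) := by
  have hsum := summable_coeff_mul_coeff_pow_mul_pow_alg hf hA hA0 hu
  -- summing over `n` first: the value is `f(A(u))`
  have h1 : HasSum (fun k : ℕ => algebraMap ℚ_[p] L (coeff k f) * (padicAlgEval L A u) ^ k)
      (∑' x : ℕ × ℕ, algebraMap ℚ_[p] L (coeff x.1 f) *
        (algebraMap ℚ_[p] L (coeff x.2 (A ^ x.1)) * u ^ x.2)) := by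
    refine hsum.hasSum.prod_fiberwise fun k => ?_
    rw [← padicAlgEval_pow hA hu k]
    exact (hasSum_padicAlgEval (hA.pow k) hu).mul_left _
  have hval : padicAlgEval L f (padicAlgEval L A u) =
      ∑' x : ℕ × ℕ, algebraMap ℚ_[p] L (coeff x.1 f) *
        (algebraMap ℚ_[p] L (coeff x.2 (A ^ x.1)) * u ^ x.2) := by
    rw [padicAlgEval_def]
    exact h1.tsum_eq
  -- summing over `k` first: the coefficients of `f ∘ A`
  have hsum' := (Equiv.prodComm ℕ ℕ).summable_iff.mpr hsum
  have h2 : HasSum (fun n : ℕ => algebraMap ℚ_[p] L (coeff n (f.subst A)) * u ^ n)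
      (∑' y : ℕ × ℕ, algebraMap ℚ_[p] L (coeff y.2 f) *
        (algebraMap ℚ_[p] L (coeff y.1 (A ^ y.2)) * u ^ y.1)) := by
    refine hsum'.hasSum.prod_fiberwise fun n => ?_
    have hfin : HasSum (fun k : ℕ => algebraMap ℚ_[p] L (coeff k f) *
        (algebraMap ℚ_[p] L (coeff n (A ^ k)) * u ^ n))
        (∑ k ∈ Finset.range (n + 1), algebraMap ℚ_[p] L (coeff k f) *
          (algebraMap ℚ_[p] L (coeff n (A ^ k)) * u ^ n)) :=
      hasSum_sum_of_ne_finset_zero fun k hk => by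
        rw [Finset.mem_range, not_lt] at hk
        rw [coeff_pow_eq_zero_of_lt' hA0 (by omega), map_zero, zero_mul, mul_zero]
    have hv : (∑ k ∈ Finset.range (n + 1), algebraMap ℚ_[p] L (coeff k f) *
        (algebraMap ℚ_[p] L (coeff n (A ^ k)) * u ^ n)) =
        algebraMap ℚ_[p] L (coeff n (f.subst A)) * u ^ n := by
      rw [coeff_subst_eq_sum_range_of_constantCoeff f hA0 n, map_sum, Finset.sum_mul]
      exact Finset.sum_congr rfl fun k _ => by rw [map_mul]; ring
    rw [← hv]
    exact hfin
  rw [hval, ← (Equiv.prodComm ℕ ℕ).tsum_eq]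
  exact h2

end Fubini

/-! ### §2 The Mercator series in `L` -/

section Mercator

variable {Λ : ℚ_[p]⟦X⟧}
  (hΛ : ∀ k, coeff k Λ = if k = 0 then 0 else (-1) ^ (k + 1) / (k : ℚ_[p]))

include hΛ

omit [IsUltrametricDist L] in
/-- **The Mercator series sums to the logarithmic series in `L`**: for `‖v‖ < 1`,
`Σ_k ι([X^k]Λ) · v^k = plog (1 + v)` (`plog y = −Σ_{n≥1} (1−y)ⁿ/n`).
[cite: Iwasawa1972PadicL, §4.4, Lemma] -/
theorem hasSum_coeff_mercator_mul_pow_alg {v : L} (hv : ‖v‖ < 1) :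
    HasSum (fun k : ℕ => algebraMap ℚ_[p] L (coeff k Λ) * v ^ k) (PadicExp.plog (1 + v)) := by
  have hy : ‖(1 : L) - (1 + v)‖ < 1 := by
    rw [show (1 : L) - (1 + v) = -v by ring, norm_neg]; exact hv
  have hlog := PadicExp.hasSum_plog (ℓ := p) (E := L) hy
  refine (hasSum_nat_add_iff' 1).mp ?_
  rw [Finset.sum_range_one, hΛ 0, if_pos rfl, map_zero, zero_mul, sub_zero]
  have hfun : (fun n : ℕ => algebraMap ℚ_[p] L (coeff (n + 1) Λ) * v ^ (n + 1)) =
      fun n : ℕ => -((1 : L) - (1 + v)) ^ (n + 1) / (n + 1) := by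
    funext n
    rw [hΛ (n + 1), if_neg (Nat.succ_ne_zero n), show (1 : L) - (1 + v) = -v by ring, neg_pow v,
      map_div₀, map_pow, map_neg, map_one, map_natCast]
    push_cast
    ring
  rw [hfun]
  exact hlog

end Mercator

/-! ### §3 `Log (F(u)) = (log F)(u)` at `L`-points -/

section LogOfEval

/-- **The logarithm of the value is the value of the formal logarithm, at `L`-points.** For
`F ∈ ℚ_p⟦X⟧` with `ℤ_p`-coefficients and `F(0) = 1`, `G` with `G(0) = 0` and `dG · F = dF`, any
`Log : L → L` agreeing with the logarithmic series on principal units, and `u ∈ L`, `‖u‖ < 1`: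
`Σ_n ι([Xⁿ]G) · uⁿ` converges to `Log (F(u))`. [cite: Iwasawa1972PadicL, §4.4]
[cite: SilvermanAEC2009, IV.6.4] [cite: Robert2000PadicAnalysis, Ch. V §4.5 Theorem (1)] -/
theorem hasSum_coeff_formalLog_mul_pow_alg {Log : L → L}
    (hLog : ∀ y : L, ‖1 - y‖ < 1 → Log y = PadicExp.plog y) {F G : ℚ_[p]⟦X⟧} (hF : IsPadicInt F)
    (hF0 : constantCoeff F = 1) (hG0 : constantCoeff G = 0)
    (hG : d⁄dX ℚ_[p] G * F = d⁄dX ℚ_[p] F) {u : L} (hu : ‖u‖ < 1) :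
    HasSum (fun n : ℕ => algebraMap ℚ_[p] L (coeff n G) * u ^ n) (Log (padicAlgEval L F u)) := by
  -- the Mercator series
  set Λ : ℚ_[p]⟦X⟧ := PowerSeries.mk fun k => if k = 0 then 0 else (-1) ^ (k + 1) / (k : ℚ_[p])
    with hΛdef
  have hΛ : ∀ k, coeff k Λ = if k = 0 then 0 else (-1) ^ (k + 1) / (k : ℚ_[p]) := fun k => by
    rw [hΛdef, coeff_mk]
  -- `A = F - 1`
  set A : ℚ_[p]⟦X⟧ := F - 1 with hAdef
  have hA : IsPadicInt A := hF.sub IsPadicInt.one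
  have hA0 : constantCoeff A = 0 := by rw [hAdef, map_sub, hF0, map_one, sub_self]
  have hs : HasSubst A := HasSubst.of_constantCoeff_zero' hA0
  have hFA : F = 1 + A := by rw [hAdef, add_sub_cancel]
  -- `Λ ∘ A = G` (formal, over `ℚ_p`)
  have hM : Λ.subst A = G := by
    refine derivative.ext ?_ ?_
    · have h1 : (d⁄dX ℚ_[p] Λ).subst A * F = 1 := by
        have h := congrArg (PowerSeries.subst A) (derivative_mercator_mul_one_add_X hΛ)
        rwa [subst_mul hs, subst_add hs, subst_X hs, one_subst_of_constantCoeff hA0, ← hFA] at h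
      have hdA : d⁄dX ℚ_[p] A = d⁄dX ℚ_[p] F := by
        rw [hAdef, map_sub, show d⁄dX ℚ_[p] (1 : ℚ_[p]⟦X⟧) = 0 from (d⁄dX ℚ_[p]).map_one_eq_zero,
          sub_zero]
      have hF' : F ≠ 0 := fun h => by
        have := congrArg constantCoeff h
        rw [hF0, map_zero] at this
        exact one_ne_zero this
      apply mul_right_cancel₀ hF'
      rw [derivative_subst ℚ_[p] hs, hG, mul_assoc, mul_comm (d⁄dX ℚ_[p] A) F, ← mul_assoc, h1,
        one_mul, hdA]
    · rw [constantCoeff_subst_of_constantCoeff Λ hA0, constantCoeff_mercator hΛ, hG0]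
  -- numerics in `L`
  have hv : ‖padicAlgEval L A u‖ < 1 := norm_padicAlgEval_lt_one hA hA0 hu
  have hFu : padicAlgEval L F u = 1 + padicAlgEval L A u := by
    rw [hFA, padicAlgEval_add IsPadicInt.one hA hu, padicAlgEval_one]
  have h1 := hasSum_coeff_subst_mul_pow_alg (L := L) (norm_coeff_mercator_le hΛ) hA hA0 hu
  have h2 := hasSum_coeff_mercator_mul_pow_alg (L := L) hΛ hv
  have hval : padicAlgEval L Λ (padicAlgEval L A u) = PadicExp.plog (1 + padicAlgEval L A u) := by
    rw [padicAlgEval_def]; exact h2.tsum_eq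
  have hlogFu : Log (padicAlgEval L F u) = PadicExp.plog (1 + padicAlgEval L A u) := by
    rw [hFu]
    refine hLog _ ?_
    rw [show (1 : L) - (1 + padicAlgEval L A u) = -padicAlgEval L A u by ring, norm_neg]
    exact hv
  rw [hM, hval, ← hlogFu] at h1
  exact h1

/-- **`Log (F(u)) = Σ' ι([Xⁿ]G) uⁿ`** for `F ∈ 1 + Xℤ_p⟦X⟧`, `G` its formal logarithm, `‖u‖ < 1`.
[cite: Iwasawa1972PadicL, §4.4] [cite: SilvermanAEC2009, IV.6.4] -/
theorem log_padicAlgEval {Log : L → L} (hLog : ∀ y : L, ‖1 - y‖ < 1 → Log y = PadicExp.plog y)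
    {F G : ℚ_[p]⟦X⟧} (hF : IsPadicInt F) (hF0 : constantCoeff F = 1) (hG0 : constantCoeff G = 0)
    (hG : d⁄dX ℚ_[p] G * F = d⁄dX ℚ_[p] F) {u : L} (hu : ‖u‖ < 1) :
    Log (padicAlgEval L F u) = ∑' n : ℕ, algebraMap ℚ_[p] L (coeff n G) * u ^ n :=
  ((hasSum_coeff_formalLog_mul_pow_alg hLog hF hF0 hG0 hG hu).tsum_eq).symm

/-- **Log-derivative form**: if `F ∈ 1 + Xℤ_p⟦X⟧` and `G(0) = 0`, `dG = dF · F⁻¹`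
(`F⁻¹ = invOfUnit F 1`), then `Σ_n ι([Xⁿ]G) uⁿ = Log F(u)` for `‖u‖ < 1` — the shape of the tree's
`padicLogSigmaSqShift`. [cite: Iwasawa1972PadicL, §4.4] [cite: SilvermanAEC2009, IV.6.4] -/
theorem hasSum_coeff_mul_pow_of_derivative_eq_mul_invOfUnit_alg {Log : L → L}
    (hLog : ∀ y : L, ‖1 - y‖ < 1 → Log y = PadicExp.plog y) {F G : ℚ_[p]⟦X⟧} (hF : IsPadicInt F)
    (hF0 : constantCoeff F = 1) (hG0 : constantCoeff G = 0)
    (hG : d⁄dX ℚ_[p] G = d⁄dX ℚ_[p] F * F.invOfUnit 1) {u : L} (hu : ‖u‖ < 1) :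
    HasSum (fun n : ℕ => algebraMap ℚ_[p] L (coeff n G) * u ^ n) (Log (padicAlgEval L F u)) := by
  refine hasSum_coeff_formalLog_mul_pow_alg hLog hF hF0 hG0 ?_ hu
  have hinv : F * F.invOfUnit 1 = 1 := PowerSeries.mul_invOfUnit F 1 (by rw [hF0, Units.val_one])
  rw [hG, mul_assoc, mul_comm (F.invOfUnit 1) F, hinv, mul_one]

end LogOfEval

end Literature.NumberTheory.EllipticCurves

end
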